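import Literature.NumberTheory.Automorphic.UnitaryGroupIsotropicFrameAction       -- ★ `exists_frameChart`'s chart formula, `frameCoords_lineRoot_zero ∕ _sum`, `frameCoords_lineDilation`
import Literature.NumberTheory.Automorphic.UnitaryGroupRankOneBigCell             -- ★ p831034: `U(σ, Φ₃)(K)` by entries, `exists_coe_eq_upper_of_mem_unipotentU`, `exists_coe_eq_diag`
import Literature.RepresentationTheory.HeisenbergGroup.SchrodingerPiOperators      -- ★ `halfForm` (the chirp datum consumed by ★ p831322)
import HarnessLib

/-!
# Crux `H413`, programme P2, N3 road (S2)-b part 1 — CHART-LEVEL DOCKING OF THE PARABOLIC OF THE ISOTROPIC LINE: the three hypotheses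
# of ★ p831043 ∕ ★ p831322 (`Y^⊥`-triviality of `N(ℓ)`, `Y`-stability of the Levi, the centre as Siegel unipotents with the ANISOTROPIC
# norm chirp) read off ★ `UnitaryGroupIsotropicFrameAction`, and the GENERATION of `N ≤ U(σ, Φ₃)(K)` by torus conjugation-quotients and commutators

Cell hodgecm-mathlib (D-0151), FLOOR 0, crux item H413 = stmt-HodgeConjecture-24833, programme P2; N3 road (`F0/P2/B-p18/g28/N3-ROAD.v1.B-p18g28.md`)
§2 (S2) ∕ (S3), desk F0P2-plan (g8) 18:45:24Z «(S2)-b TRANSPORT stays YOUR sequel».  Seat A-p12 (g17).  THEOREMS ONLY (no `def`, no instance, no notation,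
no named fact, no `sorry`); never imports a `Cruxes/…/Lines` module; kernel lane `--supports stmt-HodgeConjecture-24833 --as helper`.  HC_CM is proved only
modulo the printed citations until rung 0 closes; nothing printed is asserted here.

WHAT THE MODEL FILES CONSUME.  ★ p831322 `F0P2oHeisenbergYCoinvariantsJacquet` proves `r_N = S_Y` in the `Y`-adapted dot model `𝒮(R^{Fin 2 ⊕ Fin m})`
(`Y = 0 × (R² × 0)`, `X₀ = {x | x|_{Fin 2} = 0}`) from: (h₁) `N` acts trivially on `S_Y` — by its §4 this follows once every `n ∈ N` is a product of a
CONJUGATION-QUOTIENT `t n′ t⁻¹ n′⁻¹` (`t` `Y`-STABLE, `n′` `Y^⊥`-TRIVIAL: `g w − w ∈ Y` for `w ∈ Y^⊥`) and a COMMUTATOR of `Y^⊥`-trivial elements; (h₂) the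
centre of `N` acts through the Siegel unipotents `unipotentσ (t • c)` whose chirp `½⟨x, c x⟩` is `1` on `X₀` and ANISOTROPIC transversally to `X₀`.
This file supplies exactly these inputs:

* §1 (any field `K`, `σ` an involution, `2 ≠ 0`; `U = U(σ, Φ₃)(K)` with its Borel data ★ `torusU` ∕ `unipotentU`): the group law of `N = {u(x, z)}` by
  entries (`coe_mul_upper`, `coe_inv_upper`, `coe_conj_diag_upper`, `coe_commutator_upper` — plain `GL₃` facts), the constructor
  `exists_mem_unipotentU_coe_eq`, and **`exists_eq_conjQuot_mul_commutator`**: every `n ∈ N` is `(t n t⁻¹ n⁻¹) · (n₁ n₂ n₁⁻¹ n₂⁻¹)` with `t = d(2, 1, ½) ∈ T`,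
  `n₁, n₂ ∈ N` — so a character of `N` invariant under `T`-conjugation is trivial (the (h₁) mechanism, no input on any splitting).
* §2 (the frame chart of ★ `exists_frameChart`: quadratic coordinates `h`, hyperbolic frame `(x₀, y₀, b, a)` of `B = hermForm σ (T ⊗ 1)`, `Γv = Γ ∘ reIm`):
  **`frameCoords_lineRoot_sum_of_inl_eq_zero`** — the Eichler elements `T_{x₀}(Σ γⱼ bⱼ, τ)` of `N(ℓ)` are `Y^⊥`-TRIVIAL (`(Γv v).1|_{Fin 2} = 0 ⇒
  Γv (T v) = Γv v + (0, (y₁, 0))`); **`frameCoords_lineRoot_zero_eq_unipotentσ`** — the centre `n_t = T_{x₀}(0, φ(t) δ)` acts as `unipotentσ (t • c)` for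
  ANY linear `c` with `c x = (x₀′, −d x₁′) ⊔ 0` (such `c` exist: `exists_linearMap_lineBlock`; they are symmetric, their chirp is `½ t (x₀′² − d x₁′²) =
  ½ t N_{S∕R}(x₀′ + x₁′ δ)`, `1` on `X₀`, and anisotropic transversally to `X₀` as soon as `d` is a NON-SQUARE in `R` — `v` non-split:
  `dotProductBilin_lineBlock_symm`, `halfForm_lineBlock_eq_zero`, `inl_eq_zero_of_halfForm_lineBlock_eq_zero`); **`frameCoords_lineDilation_of_eq_zero`** —
  the Levi dilations `D(α, β)` map `Y` into `Y`.  Plus the two repackaging lemmas turning coordinate statements into the `w + (0, (y₁, 0))` ∕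
  `(0, (y₁′, 0))` shape of ★ p831043's `hp` ∕ `hq`.

NOT here (→ parts 2–3): `Gqs L v`'s Borel elements ARE these `lineRoot` ∕ `lineDilation` matrices after ★ `cmDatumLocalCongr` + `localLineInl` + `iota`
(the columns of the form congruence `T` are the hyperbolic frame); the `Ψ`-transport of `omegaLoc v` (★ `exists_intertwiner_implements_conj`, ★ `MpPsi.congr`).
[MoeglinVignerasWaldspurger1987, Chap. 3 §IV.2, §IV.5; Kudla1986, proof of Thm. 2.8; Rogawski1990, §1.10 p. 9; Dieudonne1971GroupesClassiques, Chap. II §5.]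

## References
* [MoeglinVignerasWaldspurger1987] C. Mœglin, M.-F. Vignéras, J.-L. Waldspurger, *Correspondances de Howe sur un corps p-adique*, LNM 1291 (1987): Chap. 3 §IV.2
  (the mixed model: the parabolic of an isotropic subspace acts through the Siegel parabolic of `Sp`), §IV.5 (filtration de Kudla).
* [Kudla1986] S. Kudla, *On the local theta-correspondence*, Invent. Math. 83 (1986): Thm. 2.8 and its proof.
* [Rogawski1990] J. D. Rogawski, Ann. of Math. Stud. 123 (1990): §1.9 p. 8, §1.10 p. 9 (`B = MN`, `N = {u(x, z)}`, `M = {d(α, β, ᾱ⁻¹)}`).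
* [Dieudonne1971GroupesClassiques] J. Dieudonné, *La géométrie des groupes classiques* (1971): Chap. II §5 (Eichler transformations, dilations).
-/

set_option autoImplicit false
set_option linter.dupNamespace false -- the mandated namespace repeats the single-problem summit's segment

open scoped MatrixGroups
open _root_.Matrix Literature.RepresentationTheory.HeisenbergGroup
open Literature.NumberTheory.Automorphic Literature.NumberTheory.Automorphic.UnitaryGroup
open Literature.NumberTheory.Automorphic.UnitaryGroup.QuadraticCoordinates Literature.NumberTheory.Automorphic.UnitaryGroup.IsQuadraticCoordinates

namespace Summit.HodgeConjecture.HodgeConjecture.Cruxes.H413.F0P2oParabolicLineChartDocking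

/-! ## §1 `N ≤ U(σ, Φ₃)(K)` is generated by torus conjugation-quotients and commutators -/

section Generation

variable {K : Type*} [Field K]

/-- `rev 1 = 1` in `Fin 3`. [folklore] -/
private theorem rev1 : Fin.rev (1 : Fin 3) = 1 := rfl

/-- `rev 2 = 0` in `Fin 3`. [folklore] -/
private theorem rev2 : Fin.rev (2 : Fin 3) = 0 := rfl

/-- **product of upper unitriangular `3 × 3` matrices** (the Heisenberg law of `N`): `u(x₁,y₁,z₁) u(x₂,y₂,z₂) = u(x₁+x₂, y₁+y₂, z₁+z₂+x₁y₂)`.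
[cite: Rogawski1990, §1.10 p. 9] -/
theorem coe_mul_upper {g₁ g₂ : GL (Fin 3) K} {x₁ y₁ z₁ x₂ y₂ z₂ : K}
    (h₁ : (g₁ : Matrix (Fin 3) (Fin 3) K) = !![1, x₁, z₁; 0, 1, y₁; 0, 0, 1]) (h₂ : (g₂ : Matrix (Fin 3) (Fin 3) K) = !![1, x₂, z₂; 0, 1, y₂; 0, 0, 1]) :
    ((g₁ * g₂ : GL (Fin 3) K) : Matrix (Fin 3) (Fin 3) K) = !![1, x₁ + x₂, z₁ + z₂ + x₁ * y₂; 0, 1, y₁ + y₂; 0, 0, 1] := by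
  rw [Units.val_mul, h₁, h₂]
  ext i j
  fin_cases i <;> fin_cases j <;> simp [Matrix.mul_apply, Fin.sum_univ_three]
  all_goals ring

/-- **inverse of an upper unitriangular `3 × 3` matrix**: `u(x,y,z)⁻¹ = u(−x, −y, xy − z)`. [cite: Rogawski1990, §1.10 p. 9] -/
theorem coe_inv_upper {g : GL (Fin 3) K} {x y z : K} (hg : (g : Matrix (Fin 3) (Fin 3) K) = !![1, x, z; 0, 1, y; 0, 0, 1]) :
    ((g⁻¹ : GL (Fin 3) K) : Matrix (Fin 3) (Fin 3) K) = !![1, -x, x * y - z; 0, 1, -y; 0, 0, 1] := by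
  rw [Matrix.coe_units_inv, hg]
  refine Matrix.inv_eq_left_inv ?_
  ext i j
  fin_cases i <;> fin_cases j <;> simp [Matrix.mul_apply, Fin.sum_univ_three]
  all_goals ring

/-- **torus conjugation of `N`**: `d(α,β,γ) u(x,y,z) d(α,β,γ)⁻¹ = u(α x β⁻¹, β y γ⁻¹, α z γ⁻¹)`. [cite: Rogawski1990, §1.10 p. 9] -/
theorem coe_conj_diag_upper {t g : GL (Fin 3) K} {α β γ x y z : K} (hα : α ≠ 0) (hβ : β ≠ 0) (hγ : γ ≠ 0)
    (ht : (t : Matrix (Fin 3) (Fin 3) K) = !![α, 0, 0; 0, β, 0; 0, 0, γ]) (hg : (g : Matrix (Fin 3) (Fin 3) K) = !![1, x, z; 0, 1, y; 0, 0, 1]) :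
    ((t * g * t⁻¹ : GL (Fin 3) K) : Matrix (Fin 3) (Fin 3) K) = !![1, α * x * β⁻¹, α * z * γ⁻¹; 0, 1, β * y * γ⁻¹; 0, 0, 1] := by
  have hti : ((t⁻¹ : GL (Fin 3) K) : Matrix (Fin 3) (Fin 3) K) = !![α⁻¹, 0, 0; 0, β⁻¹, 0; 0, 0, γ⁻¹] := by
    rw [Matrix.coe_units_inv, ht]
    refine Matrix.inv_eq_left_inv ?_
    ext i j
    fin_cases i <;> fin_cases j <;> simp [Matrix.mul_apply, Fin.sum_univ_three, inv_mul_cancel₀ hα, inv_mul_cancel₀ hβ, inv_mul_cancel₀ hγ]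
  rw [Units.val_mul, Units.val_mul, ht, hg, hti]
  ext i j
  fin_cases i <;> fin_cases j <;> simp [Matrix.mul_apply, Fin.sum_univ_three, mul_inv_cancel₀ hα, mul_inv_cancel₀ hβ, mul_inv_cancel₀ hγ]

/-- **commutators in `N` are central**: `u(x₁,y₁,z₁) u(x₂,y₂,z₂) u(x₁,y₁,z₁)⁻¹ u(x₂,y₂,z₂)⁻¹ = u(0, 0, x₁ y₂ − x₂ y₁)`. [cite: Rogawski1990, §1.10 p. 9] -/
theorem coe_commutator_upper {g₁ g₂ : GL (Fin 3) K} {x₁ y₁ z₁ x₂ y₂ z₂ : K}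
    (h₁ : (g₁ : Matrix (Fin 3) (Fin 3) K) = !![1, x₁, z₁; 0, 1, y₁; 0, 0, 1]) (h₂ : (g₂ : Matrix (Fin 3) (Fin 3) K) = !![1, x₂, z₂; 0, 1, y₂; 0, 0, 1]) :
    ((g₁ * g₂ * g₁⁻¹ * g₂⁻¹ : GL (Fin 3) K) : Matrix (Fin 3) (Fin 3) K) = !![1, 0, x₁ * y₂ - x₂ * y₁; 0, 1, 0; 0, 0, 1] := by
  rw [coe_mul_upper (coe_mul_upper (coe_mul_upper h₁ h₂) (coe_inv_upper h₁)) (coe_inv_upper h₂)]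
  ext i j
  fin_cases i <;> fin_cases j <;> simp
  all_goals ring

variable (σ : K →+* K) {J : Matrix (Fin 3) (Fin 3) K} (hJ : J = (StdForm.antidiagonal 3).over K)

include hJ in
/-- **the upper unitriangular unitary element `u(x, z) = !![1, x, z; 0, 1, −σ x; 0, 0, 1] ∈ N`** as soon as `z + σ z + x σ x = 0` (Rogawski's `N = {u(x, z)}`;
the constructor companion of ★ `exists_coe_eq_upper_of_mem_unipotentU`). [cite: Rogawski1990, §1.10 p. 9] -/
theorem exists_mem_unipotentU_coe_eq (hσσ : ∀ x, σ (σ x) = x) {x z : K} (hrel : z + σ z + x * σ x = 0) :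
    ∃ u : ↥(unitaryGroupOfForm σ J), u ∈ unipotentU σ J ∧ ((u : GL (Fin 3) K) : Matrix (Fin 3) (Fin 3) K) = !![1, x, z; 0, 1, -σ x; 0, 0, 1] := by
  have hdet : (!![(1 : K), x, z; 0, 1, -σ x; 0, 0, 1] : Matrix (Fin 3) (Fin 3) K).det ≠ 0 := by
    rw [Matrix.det_fin_three]; simp
  have hmem : Matrix.GeneralLinearGroup.mkOfDetNeZero _ hdet ∈ unitaryGroupOfForm σ J := by
    rw [hJ, mem_unitaryGroupOfForm_antidiagonal_iff_sum']
    intro a b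
    fin_cases a <;> fin_cases b <;>
      simp [Fin.sum_univ_three, rev1, rev2, Matrix.GeneralLinearGroup.val_mkOfDetNeZero, map_neg, hσσ]
    · linear_combination hrel
  refine ⟨⟨_, hmem⟩, ?_, Matrix.GeneralLinearGroup.val_mkOfDetNeZero _ _⟩
  rw [mem_unipotentU_iff]
  refine ⟨?_, ?_⟩
  · intro i j hij
    change (Matrix.GeneralLinearGroup.mkOfDetNeZero _ hdet : Matrix (Fin 3) (Fin 3) K) i j = 0
    rw [Matrix.GeneralLinearGroup.val_mkOfDetNeZero]
    fin_cases i <;> fin_cases j <;> simp at hij ⊢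
  · intro i
    change (Matrix.GeneralLinearGroup.mkOfDetNeZero _ hdet : Matrix (Fin 3) (Fin 3) K) i i = 1
    rw [Matrix.GeneralLinearGroup.val_mkOfDetNeZero]
    fin_cases i <;> simp

include hJ in
/-- **`N` IS GENERATED BY TORUS CONJUGATION-QUOTIENTS AND COMMUTATORS, elementwise**: for `σ` an involution and `2 ≠ 0`, every `n = u(x, z) ∈ N` is
`n = (t n t⁻¹ n⁻¹) · (n₁ n₂ n₁⁻¹ n₂⁻¹)` with `t = d(2, 1, ½) ∈ T` (`t u(x,z) t⁻¹ = u(2x, 4z)`), `n₁ = u(1, −½)`, `n₂ = u(c∕2, c²∕8)`, `c = σ z − z`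
(`[n₁, n₂] = u(0, c)`).  Hence a character of `N` that is invariant under `T`-conjugation is TRIVIAL — the mechanism of (h₁) of ★ p831322 (`N(ℓ)` acts
trivially on `S_Y`), with no input on the metaplectic splitting. [cite: Rogawski1990, §1.10 p. 9] [cite: MoeglinVignerasWaldspurger1987, Chap. 3 §IV.5] -/
theorem exists_eq_conjQuot_mul_commutator (hσσ : ∀ x, σ (σ x) = x) (h2 : (2 : K) ≠ 0) {n : ↥(unitaryGroupOfForm σ J)}
    (hn : n ∈ unipotentU σ J) :
    ∃ t : ↥(unitaryGroupOfForm σ J), t ∈ torusU σ J ∧ ∃ n₁ : ↥(unitaryGroupOfForm σ J), n₁ ∈ unipotentU σ J ∧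
      ∃ n₂ : ↥(unitaryGroupOfForm σ J), n₂ ∈ unipotentU σ J ∧ n = t * n * t⁻¹ * n⁻¹ * (n₁ * n₂ * n₁⁻¹ * n₂⁻¹) := by
  obtain ⟨x, z, hnc, hrel⟩ := exists_coe_eq_upper_of_mem_unipotentU σ hJ hσσ hn
  have hσ2 : σ 2 = 2 := map_ofNat σ 2
  have hhalf : (2 : K)⁻¹ + 2⁻¹ = 1 := by rw [← two_mul, mul_inv_cancel₀ h2]
  have hσhalf : σ 2⁻¹ = 2⁻¹ := by rw [map_inv₀, hσ2]
  -- the torus element `t = d(2, 1, ½)`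
  obtain ⟨t, htT, htc⟩ := exists_coe_eq_diag σ hJ hσσ (α := (2 : K)) (β := 1) h2 (by rw [map_one, mul_one])
  rw [hσ2] at htc
  -- `n₁ = u(1, -½)`
  obtain ⟨n₁, hn₁, hn₁c⟩ := exists_mem_unipotentU_coe_eq σ hJ hσσ (x := (1 : K)) (z := -2⁻¹)
    (by rw [map_neg, hσhalf, map_one, mul_one]; linear_combination -hhalf)
  -- `n₂ = u(c/2, c²/8)`, `c = σ z - z`
  set c : K := σ z - z with hc
  have hσc : σ c = -c := by rw [hc, map_sub, hσσ]; ring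
  obtain ⟨n₂, hn₂, hn₂c⟩ := exists_mem_unipotentU_coe_eq σ hJ hσσ (x := c * 2⁻¹) (z := c * c * 2⁻¹ * 2⁻¹ * 2⁻¹)
    (by simp only [map_mul, hσc, hσhalf]; linear_combination (c * c * 2⁻¹ * 2⁻¹) * hhalf)
  refine ⟨t, htT, n₁, hn₁, n₂, hn₂, Subtype.ext (Units.ext ?_)⟩
  -- the matrix identity `u(x,z) = (t u t⁻¹ u⁻¹) [n₁, n₂]`
  have hA := coe_mul_upper (coe_conj_diag_upper (γ := (2 : K)⁻¹) h2 one_ne_zero (inv_ne_zero h2) htc hnc) (coe_inv_upper hnc)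
  have hB := coe_commutator_upper hn₁c hn₂c
  have hAB := coe_mul_upper hA hB
  simp only [Subgroup.coe_mul, Subgroup.coe_inv]
  rw [hnc, hAB]
  simp only [map_mul, map_one, hσc, hσhalf, inv_inv, inv_one]
  ext i j
  fin_cases i <;> fin_cases j <;> simp
  · ring
  · linear_combination -hrel - (σ z - z) * hhalf
  · ring

end Generation

/-! ## §2 The parabolic of the line in the frame chart: `Y^⊥`-triviality, the centre as anisotropic Siegel unipotents, `Y`-stability of the Levi -/

section Chart

variable {R S : Type*} [Field R] [CommRing S]
variable {φ : R →+* S} {Ψ : (R × R) ≃+ S} {δ : S} {d : R} (h : IsQuadraticCoordinates φ Ψ δ d)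
variable {n : Type*} [Fintype n] [DecidableEq n]
variable {T : Matrix n n R} {σ : S →+* S} {m : ℕ} {x₀ y₀ : n → S} {b : Fin m → n → S} {a : Fin m → R}
variable (Γv : (n → S) → ((Fin 2 ⊕ Fin m) → R) × ((Fin 2 ⊕ Fin m) → R))
variable (hΓ : ∀ v : n → S, Γv v =
  (Sum.elim ![re Ψ (hermForm σ (T.map φ) x₀ v), im Ψ (hermForm σ (T.map φ) x₀ v)]
      (fun j => (a j)⁻¹ * re Ψ (hermForm σ (T.map φ) (b j) v)),
    Sum.elim ![im Ψ (hermForm σ (T.map φ) y₀ v), -re Ψ (hermForm σ (T.map φ) y₀ v)]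
      (fun j => im Ψ (hermForm σ (T.map φ) (b j) v))))

/-- **repackaging (`hp` shape)**: a pair with the same translation coordinates and the same `Fin m` modulation coordinates as `w` is `w + (0, (y₁, 0))` —
the «`g w − w ∈ Y`» of ★ p831043. [cite: MoeglinVignerasWaldspurger1987, Chap. 3 §IV.2] -/
theorem exists_eq_add_inr_zero {p w : ((Fin 2 ⊕ Fin m) → R) × ((Fin 2 ⊕ Fin m) → R)} (h1 : p.1 = w.1) (h2 : p.2 ∘ Sum.inr = w.2 ∘ Sum.inr) :
    ∃ y₁ : Fin 2 → R, p = w + (0, Sum.elim y₁ 0) := by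
  refine ⟨fun i => p.2 (Sum.inl i) - w.2 (Sum.inl i), Prod.ext ?_ (funext fun k => ?_)⟩
  · rw [Prod.fst_add, h1, add_zero]
  · rcases k with i | j
    · simp only [Prod.snd_add, Pi.add_apply, Sum.elim_inl]
      ring
    · simp only [Prod.snd_add, Pi.add_apply, Sum.elim_inr, Pi.zero_apply, add_zero]
      exact congr_fun h2 j

/-- **repackaging (`hq` shape)**: a pair with zero translation coordinates and zero `Fin m` modulation coordinates is `(0, (y₁′, 0))` — «in `Y`».
[cite: MoeglinVignerasWaldspurger1987, Chap. 3 §IV.2] -/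
theorem exists_eq_zero_inl {p : ((Fin 2 ⊕ Fin m) → R) × ((Fin 2 ⊕ Fin m) → R)} (h1 : p.1 = 0) (h2 : p.2 ∘ Sum.inr = 0) :
    ∃ y₁' : Fin 2 → R, p = (0, Sum.elim y₁' 0) := by
  refine ⟨p.2 ∘ Sum.inl, Prod.ext h1 ?_⟩
  change p.2 = Sum.elim (p.2 ∘ Sum.inl) 0
  rw [← h2, Sum.elim_comp_inl_inr]

/-- conversely `(0, (y₁, 0))` has zero translation coordinates and zero `Fin m` modulation coordinates. [folklore] -/
theorem fst_eq_zero_and_of_eq_zero_inl {p : ((Fin 2 ⊕ Fin m) → R) × ((Fin 2 ⊕ Fin m) → R)} {y₁ : Fin 2 → R} (hp : p = (0, Sum.elim y₁ 0)) :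
    p.1 = 0 ∧ p.2 ∘ Sum.inr = 0 := by
  subst hp
  exact ⟨rfl, Sum.elim_comp_inr _ _⟩

include h hΓ in
/-- **THE EICHLER ELEMENTS OF `N(ℓ)` ARE `Y^⊥`-TRIVIAL** (coordinates): if the translation coordinates of the line vanish at `v` (`(Γv v).1|_{Fin 2} = 0`, i.e.
`Γv v ∈ Y^⊥`), then `T_{x₀}(Σ γⱼ bⱼ, τ)` does not change the translation coordinates nor the `Fin m` modulation coordinates (★ `frameCoords_lineRoot_sum` at
`λ = 0`). [cite: MoeglinVignerasWaldspurger1987, Chap. 3 §IV.2] -/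
theorem frameCoords_lineRoot_sum_of_inl_eq_zero (hx : hermForm σ (T.map φ) x₀ x₀ = 0) (hyx : hermForm σ (T.map φ) y₀ x₀ = 1)
    (hxb : ∀ j, hermForm σ (T.map φ) x₀ (b j) = 0) (hyb : ∀ j, hermForm σ (T.map φ) y₀ (b j) = 0)
    (hbx : ∀ j, hermForm σ (T.map φ) (b j) x₀ = 0)
    (hbb : ∀ j j', j ≠ j' → hermForm σ (T.map φ) (b j) (b j') = 0) (hba : ∀ j, hermForm σ (T.map φ) (b j) (b j) = φ (a j))
    (ha : ∀ j, a j ≠ 0) (γ : Fin m → S) (τ : S) (v : n → S) (hv : (Γv v).1 ∘ Sum.inl = 0) :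
    (Γv (lineRoot σ (T.map φ) x₀ (∑ j, γ j • b j) τ *ᵥ v)).1 = (Γv v).1 ∧
      (Γv (lineRoot σ (T.map φ) x₀ (∑ j, γ j • b j) τ *ᵥ v)).2 ∘ Sum.inr = (Γv v).2 ∘ Sum.inr := by
  have h0 : (Γv v).1 (Sum.inl 0) = 0 := congr_fun hv 0
  have h1 : (Γv v).1 (Sum.inl 1) = 0 := congr_fun hv 1
  have hΨ0 : Ψ ((Γv v).1 (Sum.inl 0), (Γv v).1 (Sum.inl 1)) = 0 := by rw [h0, h1]; exact map_zero Ψ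
  rw [frameCoords_lineRoot_sum h Γv hΓ hx hyx hxb hyb hbx hbb hba ha γ τ v]
  refine ⟨funext fun k => ?_, funext fun k => ?_⟩
  · rcases k with i | j
    · fin_cases i
      · simp [h0]
      · simp [h1]
    · simp [hΨ0]
  · simp [hΨ0]

include h hΓ in
/-- **`hp` of ★ p831043 for the Eichler elements**: `Γv v ∈ Y^⊥ ⇒ Γv (T_{x₀}(Σ γⱼ bⱼ, τ) v) = Γv v + (0, (y₁, 0))` for some `y₁`.
[cite: MoeglinVignerasWaldspurger1987, Chap. 3 §IV.2] [cite: Kudla1986, proof of Thm. 2.8] -/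
theorem exists_frameCoords_lineRoot_sum_eq_add (hx : hermForm σ (T.map φ) x₀ x₀ = 0) (hyx : hermForm σ (T.map φ) y₀ x₀ = 1)
    (hxb : ∀ j, hermForm σ (T.map φ) x₀ (b j) = 0) (hyb : ∀ j, hermForm σ (T.map φ) y₀ (b j) = 0)
    (hbx : ∀ j, hermForm σ (T.map φ) (b j) x₀ = 0)
    (hbb : ∀ j j', j ≠ j' → hermForm σ (T.map φ) (b j) (b j') = 0) (hba : ∀ j, hermForm σ (T.map φ) (b j) (b j) = φ (a j))
    (ha : ∀ j, a j ≠ 0) (γ : Fin m → S) (τ : S) (v : n → S) (hv : (Γv v).1 ∘ Sum.inl = 0) :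
    ∃ y₁ : Fin 2 → R, Γv (lineRoot σ (T.map φ) x₀ (∑ j, γ j • b j) τ *ᵥ v) = Γv v + (0, Sum.elim y₁ 0) := by
  obtain ⟨h1, h2⟩ := frameCoords_lineRoot_sum_of_inl_eq_zero h Γv hΓ hx hyx hxb hyb hbx hbb hba ha γ τ v hv
  exact exists_eq_add_inr_zero h1 h2

include h hΓ in
/-- **THE CENTRE OF `N(ℓ)` ACTS AS THE SIEGEL UNIPOTENTS OF THE ANISOTROPIC NORM CHIRP**: the transvection `n_t = T_{x₀}(0, φ(t) δ)` is, in the chart,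
`unipotentσ (t • c)` for ANY linear `c` with `c x = (x₀′, −d x₁′) ⊔ 0` (★ `frameCoords_lineRoot_zero`) — the `hZ` of ★ p831322 `exists_toRep_comp_eq_unipOpPi`.
[cite: MoeglinVignerasWaldspurger1987, Chap. 3 §IV.2] [cite: Kudla1986, proof of Thm. 2.8] -/
theorem frameCoords_lineRoot_zero_eq_unipotentσ (hx : hermForm σ (T.map φ) x₀ x₀ = 0) (hyx : hermForm σ (T.map φ) y₀ x₀ = 1)
    (hbx : ∀ j, hermForm σ (T.map φ) (b j) x₀ = 0) (c : ((Fin 2 ⊕ Fin m) → R) →ₗ[R] ((Fin 2 ⊕ Fin m) → R))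
    (hc : ∀ x : (Fin 2 ⊕ Fin m) → R, c x = Sum.elim ![x (Sum.inl 0), -d * x (Sum.inl 1)] 0) (t : R) (v : n → S) :
    Γv (lineRoot σ (T.map φ) x₀ 0 (φ t * δ) *ᵥ v) = unipotentσ (t • c) (Γv v) := by
  rw [frameCoords_lineRoot_zero h Γv hΓ hx hyx hbx t v, unipotentσ_apply, LinearMap.smul_apply, hc]
  refine Prod.ext rfl ?_
  change (Γv v).2 + _ = (Γv v).2 + _
  congr 1
  funext k
  rcases k with i | j
  · fin_cases i
    · simp [smul_eq_mul]
    · simp [smul_eq_mul]; ring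
  · simp

/-- **such `c` exist** (no `def` in this file: the consumer obtains one here). [folklore] -/
theorem exists_linearMap_lineBlock (d' : R) :
    ∃ c : ((Fin 2 ⊕ Fin m) → R) →ₗ[R] ((Fin 2 ⊕ Fin m) → R), ∀ x, c x = Sum.elim ![x (Sum.inl 0), -d' * x (Sum.inl 1)] 0 := by
  have hadd : ∀ x y : (Fin 2 ⊕ Fin m) → R, (Sum.elim ![(x + y) (Sum.inl 0), -d' * (x + y) (Sum.inl 1)] 0 : (Fin 2 ⊕ Fin m) → R) =
      Sum.elim ![x (Sum.inl 0), -d' * x (Sum.inl 1)] 0 + Sum.elim ![y (Sum.inl 0), -d' * y (Sum.inl 1)] 0 := by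
    intro x y
    funext k
    rcases k with i | j
    · fin_cases i
      · simp
      · simp [mul_add]
    · simp
  have hsmul : ∀ (r : R) (x : (Fin 2 ⊕ Fin m) → R), (Sum.elim ![(r • x) (Sum.inl 0), -d' * (r • x) (Sum.inl 1)] 0 : (Fin 2 ⊕ Fin m) → R) =
      r • Sum.elim ![x (Sum.inl 0), -d' * x (Sum.inl 1)] 0 := by
    intro r x
    funext k
    rcases k with i | j
    · fin_cases i
      · simp
      · simp [mul_left_comm]
    · simp
  exact ⟨{ toFun := fun x => Sum.elim ![x (Sum.inl 0), -d' * x (Sum.inl 1)] 0, map_add' := hadd, map_smul' := hsmul },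
    fun x => rfl⟩

/-- **`c` is symmetric** (`hc` of ★ `unipotentSp` ∕ ★ p831322 §5). [cite: Weil1964, n° 6, p. 151] -/
theorem dotProductBilin_lineBlock_symm (c : ((Fin 2 ⊕ Fin m) → R) →ₗ[R] ((Fin 2 ⊕ Fin m) → R))
    (hc : ∀ x : (Fin 2 ⊕ Fin m) → R, c x = Sum.elim ![x (Sum.inl 0), -d * x (Sum.inl 1)] 0) (x x' : (Fin 2 ⊕ Fin m) → R) :
    dotProductBilin R R x (c x') = dotProductBilin R R x' (c x) := by
  rw [dotProductBilin_apply_apply, dotProductBilin_apply_apply, hc, hc, dotProduct, dotProduct, Fintype.sum_sum_type,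
    Fintype.sum_sum_type, Fin.sum_univ_two, Fin.sum_univ_two]
  simp only [Sum.elim_inl, Sum.elim_inr, Matrix.cons_val_zero, Matrix.cons_val_one, Pi.zero_apply, mul_zero,
    Finset.sum_const_zero, add_zero]
  ring

/-- **the chirp of `c`**: `½⟨x, c x⟩ = ½ (x₀′² − d x₁′²)` = `½ N_{S∕R}(x₀′ + x₁′ δ)` on the translation coordinates of the line.
[cite: MoeglinVignerasWaldspurger1987, Chap. 3 §IV.2] [cite: GelbartRogawski1991, §3.2 (3.2.3) p. 457] -/
theorem halfForm_lineBlock [Invertible (2 : R)] (c : ((Fin 2 ⊕ Fin m) → R) →ₗ[R] ((Fin 2 ⊕ Fin m) → R))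
    (hc : ∀ x : (Fin 2 ⊕ Fin m) → R, c x = Sum.elim ![x (Sum.inl 0), -d * x (Sum.inl 1)] 0) (x : (Fin 2 ⊕ Fin m) → R) :
    halfForm c x = ⅟(2 : R) * (x (Sum.inl 0) * x (Sum.inl 0) - d * (x (Sum.inl 1) * x (Sum.inl 1))) := by
  rw [halfForm_apply, hc, dotProduct, Fintype.sum_sum_type, Fin.sum_univ_two]
  simp only [Sum.elim_inl, Sum.elim_inr, Matrix.cons_val_zero, Matrix.cons_val_one, Pi.zero_apply, mul_zero,
    Finset.sum_const_zero, add_zero]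
  ring

/-- **the chirp is `1` on `X₀`** (`hc0` of ★ p831322): `x|_{Fin 2} = 0 ⇒ ½⟨x, c x⟩ = 0`. [cite: Kudla1986, proof of Thm. 2.8] -/
theorem halfForm_lineBlock_eq_zero [Invertible (2 : R)] (c : ((Fin 2 ⊕ Fin m) → R) →ₗ[R] ((Fin 2 ⊕ Fin m) → R))
    (hc : ∀ x : (Fin 2 ⊕ Fin m) → R, c x = Sum.elim ![x (Sum.inl 0), -d * x (Sum.inl 1)] 0) (x : (Fin 2 ⊕ Fin m) → R)
    (hx : x ∘ Sum.inl = 0) : halfForm c x = 0 := by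
  have h0 : x (Sum.inl 0) = 0 := congr_fun hx 0
  have h1 : x (Sum.inl 1) = 0 := congr_fun hx 1
  rw [halfForm_lineBlock c hc, h0, h1]
  ring

/-- **the chirp is ANISOTROPIC transversally to `X₀` when `d` is a non-square** (`hca` of ★ p831322; at a place `v` of `L⁺` NOT split in `L`, `d = δ²`
is not a square in `L⁺_v`): `½⟨x, c x⟩ = 0 ⇒ x|_{Fin 2} = 0`. [cite: Kudla1986, Thm. 2.8 (anisotropic case)] [cite: GelbartRogawski1991, §3.2 (3.2.3) p. 457] -/
theorem inl_eq_zero_of_halfForm_lineBlock_eq_zero [Invertible (2 : R)] (hd : ∀ r : R, r * r ≠ d)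
    (c : ((Fin 2 ⊕ Fin m) → R) →ₗ[R] ((Fin 2 ⊕ Fin m) → R))
    (hc : ∀ x : (Fin 2 ⊕ Fin m) → R, c x = Sum.elim ![x (Sum.inl 0), -d * x (Sum.inl 1)] 0) (x : (Fin 2 ⊕ Fin m) → R)
    (hq : halfForm c x = 0) : x ∘ Sum.inl = 0 := by
  rw [halfForm_lineBlock c hc] at hq
  have h2 : (⅟(2 : R)) ≠ 0 := (isUnit_of_invertible (⅟(2 : R))).ne_zero
  have hq' : x (Sum.inl 0) * x (Sum.inl 0) - d * (x (Sum.inl 1) * x (Sum.inl 1)) = 0 :=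
    (mul_eq_zero.1 hq).resolve_left h2
  have hx1 : x (Sum.inl 1) = 0 := by
    by_contra hne
    apply hd (x (Sum.inl 0) / x (Sum.inl 1))
    field_simp
    linear_combination hq'
  have hx0 : x (Sum.inl 0) = 0 := by
    rw [hx1, mul_zero, mul_zero, sub_zero] at hq'
    exact mul_self_eq_zero.1 hq'
  funext i
  fin_cases i
  · exact hx0
  · exact hx1

include h hΓ in
/-- **THE LEVI DILATIONS ARE `Y`-STABLE** (coordinates): `D(α, β)` acts on the translation coordinates of the line by `Res(β)`, on its modulation
coordinates by a `2 × 2` block, and fixes the `Fin m` coordinates (★ `frameCoords_lineDilation`); hence it maps `Y = {x = 0, y|_{Fin m} = 0}` into itself —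
the `hq` of ★ p831043 `fibreZero_toRep_conj_eq_smul` for the torus `m(α) = D(α, (σα)⁻¹)`. [cite: MoeglinVignerasWaldspurger1987, Chap. 3 §IV.2] -/
theorem frameCoords_lineDilation_of_eq_zero (hx : hermForm σ (T.map φ) x₀ x₀ = 0) (hy : hermForm σ (T.map φ) y₀ y₀ = 0)
    (hxy : hermForm σ (T.map φ) x₀ y₀ = 1) (hyx : hermForm σ (T.map φ) y₀ x₀ = 1)
    (hbx : ∀ j, hermForm σ (T.map φ) (b j) x₀ = 0) (hby : ∀ j, hermForm σ (T.map φ) (b j) y₀ = 0) (α β : S) (v : n → S)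
    (hv1 : (Γv v).1 = 0) (hv2 : (Γv v).2 ∘ Sum.inr = 0) :
    (Γv (lineDilation σ (T.map φ) x₀ y₀ α β *ᵥ v)).1 = 0 ∧ (Γv (lineDilation σ (T.map φ) x₀ y₀ α β *ᵥ v)).2 ∘ Sum.inr = 0 := by
  have h0 : ∀ k, (Γv v).1 k = 0 := fun k => congr_fun hv1 k
  have h0' : ∀ j, (Γv v).2 (Sum.inr j) = 0 := fun j => congr_fun hv2 j
  rw [frameCoords_lineDilation h Γv hΓ hx hy hxy hyx hbx hby α β v]
  refine ⟨funext fun k => ?_, funext fun j => ?_⟩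
  · rcases k with i | j
    · fin_cases i
      · simp [h0]
      · simp [h0]
    · simp [h0]
  · simp [h0']

include h hΓ in
/-- **`hq` of ★ p831043 for the Levi**: `Γv v ∈ Y ⇒ Γv (D(α, β) v) ∈ Y`, in the `(0, (y₁, 0))` shape. [cite: MoeglinVignerasWaldspurger1987, Chap. 3 §IV.2] -/
theorem exists_frameCoords_lineDilation_eq (hx : hermForm σ (T.map φ) x₀ x₀ = 0) (hy : hermForm σ (T.map φ) y₀ y₀ = 0)
    (hxy : hermForm σ (T.map φ) x₀ y₀ = 1) (hyx : hermForm σ (T.map φ) y₀ x₀ = 1)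
    (hbx : ∀ j, hermForm σ (T.map φ) (b j) x₀ = 0) (hby : ∀ j, hermForm σ (T.map φ) (b j) y₀ = 0) (α β : S) (v : n → S)
    {y₁ : Fin 2 → R} (hv : Γv v = (0, Sum.elim y₁ 0)) :
    ∃ y₁' : Fin 2 → R, Γv (lineDilation σ (T.map φ) x₀ y₀ α β *ᵥ v) = (0, Sum.elim y₁' 0) := by
  obtain ⟨hv1, hv2⟩ := fst_eq_zero_and_of_eq_zero_inl hv
  obtain ⟨h1, h2⟩ := frameCoords_lineDilation_of_eq_zero h Γv hΓ hx hy hxy hyx hbx hby α β v hv1 hv2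
  exact exists_eq_zero_inl h1 h2

end Chart


end Summit.HodgeConjecture.HodgeConjecture.Cruxes.H413.F0P2oParabolicLineChartDocking
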